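import Summits.Ventures.HodgeRepro.T3ForcedFourth
import Summits.Ventures.HodgeRepro.T3FourthLine

/-!
# On a face the fourth skew-hermitian line is admissible — the two halves of (N1-disc) composed (T3.3)

Blind re-derivation cell `pub-hodge-repro`, Tier 3, seat `t3-p2` (prover-pub-hodge-repro-t3-p2-g2-0), sub-goal T3.3 of
`route/TIER3.md` (§7 «(N1-disc) IS FREE»).  Target tree path `lean/Summits/Ventures/HodgeRepro/T3FaceFourthLine.lean`.
Imports: this seat's `T3ForcedFourth` (the parity of the four corner lines on the group model) and `T3FourthLine`
(the admissibility of `e₁ e₂ / e₃` from the parity) — Mathlib + `Summits/Ventures/HodgeRepro/` only.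

`T3ForcedFourth.even_card_negative_lines` lives on the group model `(G, c)` of the Galois CM field `E′` (CM types
as finite subsets of `G`), `T3FourthLine.fourth_line_admissible` on the complex embeddings `E′ →+* ℂ` of the actual
field.  The dictionary between the two is an INJECTIVE map `emb : G → (E′ →+* ℂ)` (for `G = Gal(E′/ℚ)` and a fixed
embedding `φ₀`: `g ↦ φ₀ ∘ g`); a CM type `Φ ⊆ G` becomes the finite set `Φ.image emb` of embeddings.  The parity
transfers along ANY injective `emb`: at an embedding `φ = emb g` the four memberships are those of `g` on the model,
and at an embedding outside the image all four are false (sum `0`, even).  Hence: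

* `even_image_negative_lines` — the parity identity of `T3ForcedFourth` read on the embeddings `Φ.image emb`;
* `fourth_line_admissible_of_face` — **(N1-disc) on a face, end to end**: for a face `T` (`SumTwo`, four CM-type
  corners), the component `s`, the corners `i₁ ≠ i₂ ∋ s` and `i₃ ≠ i₄ ∋ c * s`, and non-zero purely imaginary
  `e₁, e₂, e₃ ∈ E′` admissible (Liu Def 4.12, two-sided) for the CM types `s • (T i₁)⁻¹`, `s • (T i₂)⁻¹`,
  `(c * s) • (T i₃)⁻¹` read as embedding sets, the element `e₄ := e₁ e₂ / e₃` is non-zero, purely imaginary,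
  admissible for `(c * s) • (T i₄)⁻¹`, and `e₁ e₂ = e₃ e₄`: the discriminant half of N1 is met by a choice, with no
  condition on the corners beyond the face condition (`proofs/t3-p2/R3R4-INSTANTIATION.md` §4.4).

Nothing here says anything about the status of the Hodge conjecture for CM abelian varieties, which is NOT proved.
-/

set_option autoImplicit false

open Finset
open scoped Pointwise

namespace HodgeRepro

namespace T3.FaceFourthLine

open HodgeRepro.RouteC (liuType)
open NumberField

variable {G : Type*} [Group G] [DecidableEq G]
variable {ι : Type*} [Fintype ι] [DecidableEq ι]
variable {L : Type} [Field L] [NumberField L] [NumberField.IsCMField L] [DecidableEq (L →+* ℂ)]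

omit [NumberField L] [NumberField.IsCMField L] in
/-- **The parity identity on the embeddings.**  For an injective dictionary `emb : G → (L →+* ℂ)` and a face as in
`T3ForcedFourth.even_card_negative_lines`, at every complex embedding `φ` an even number of the four embedding sets
`(s • (T i₁)⁻¹).image emb`, `(s • (T i₂)⁻¹).image emb`, `((c * s) • (T i₃)⁻¹).image emb`, `((c * s) • (T i₄)⁻¹).image emb`
contains `φ`. -/
theorem even_image_negative_lines (emb : G → (L →+* ℂ)) (hemb : Function.Injective emb) {c : G}
    (hc : IsComplexConj c) (T : ι → Finset G) (hT : ∀ i, IsCMType c (T i)) (h2 : SumTwo T)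
    (h4 : Fintype.card ι = 4) {s : G} {i₁ i₂ i₃ i₄ : ι} (h12 : i₁ ≠ i₂) (hs₁ : s ∈ T i₁) (hs₂ : s ∈ T i₂)
    (h34 : i₃ ≠ i₄) (hs₃ : c * s ∈ T i₃) (hs₄ : c * s ∈ T i₄) (φ : L →+* ℂ) :
    Even ((if φ ∈ (s • liuType (T i₁)).image emb then 1 else 0)
        + (if φ ∈ (s • liuType (T i₂)).image emb then 1 else 0)
        + (if φ ∈ ((c * s) • liuType (T i₃)).image emb then 1 else 0)
        + (if φ ∈ ((c * s) • liuType (T i₄)).image emb then 1 else 0) : ℕ) := by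
  by_cases hφ : ∃ g : G, emb g = φ
  · obtain ⟨g, rfl⟩ := hφ
    simp only [hemb.mem_finset_image]
    exact T3.ForcedFourth.even_card_negative_lines hc T hT h2 h4 h12 hs₁ hs₂ h34 hs₃ hs₄ g
  · have hnot : ∀ Φ : Finset G, φ ∉ Φ.image emb := by
      intro Φ hΦ
      obtain ⟨g, _, hg⟩ := mem_image.1 hΦ
      exact hφ ⟨g, hg⟩
    simp only [hnot, if_false, add_zero]
    exact ⟨0, rfl⟩

/-- **(N1-disc) on a face, end to end.**  Let `emb : G → (L →+* ℂ)` be an injective dictionary between the group model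
and the complex embeddings of the CM field `L`, `T` a face (`SumTwo`, four CM-type corners), `s` the component, `i₁ ≠ i₂`
the corners containing `s` and `i₃ ≠ i₄` those containing `c * s`.  If `e₁, e₂, e₃ ∈ L` are non-zero purely imaginary
elements admissible for the CM types `s • (T i₁)⁻¹`, `s • (T i₂)⁻¹`, `(c * s) • (T i₃)⁻¹` (read on the embeddings through
`emb`: `Im φ(e_j) < 0 ↔ φ ∈ Φ_j.image emb`), then `e₄ := e₁ e₂ / e₃` is non-zero, purely imaginary, admissible for the
fourth corner's CM type `(c * s) • (T i₄)⁻¹`, and `e₁ e₂ = e₃ e₄`. -/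
theorem fourth_line_admissible_of_face (emb : G → (L →+* ℂ)) (hemb : Function.Injective emb) {c : G}
    (hc : IsComplexConj c) (T : ι → Finset G) (hT : ∀ i, IsCMType c (T i)) (h2 : SumTwo T)
    (h4 : Fintype.card ι = 4) {s : G} {i₁ i₂ i₃ i₄ : ι} (h12 : i₁ ≠ i₂) (hs₁ : s ∈ T i₁) (hs₂ : s ∈ T i₂)
    (h34 : i₃ ≠ i₄) (hs₃ : c * s ∈ T i₃) (hs₄ : c * s ∈ T i₄) {e₁ e₂ e₃ : L}
    (h₁ : IsCMField.complexConj L e₁ = -e₁) (h₁0 : e₁ ≠ 0)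
    (hΦ₁ : ∀ φ : L →+* ℂ, (φ e₁).im < 0 ↔ φ ∈ (s • liuType (T i₁)).image emb)
    (h₂ : IsCMField.complexConj L e₂ = -e₂) (h₂0 : e₂ ≠ 0)
    (hΦ₂ : ∀ φ : L →+* ℂ, (φ e₂).im < 0 ↔ φ ∈ (s • liuType (T i₂)).image emb)
    (h₃ : IsCMField.complexConj L e₃ = -e₃) (h₃0 : e₃ ≠ 0)
    (hΦ₃ : ∀ φ : L →+* ℂ, (φ e₃).im < 0 ↔ φ ∈ ((c * s) • liuType (T i₃)).image emb) :
    IsCMField.complexConj L (e₁ * e₂ / e₃) = -(e₁ * e₂ / e₃) ∧ e₁ * e₂ / e₃ ≠ 0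
      ∧ (∀ φ : L →+* ℂ, (φ (e₁ * e₂ / e₃)).im < 0 ↔ φ ∈ ((c * s) • liuType (T i₄)).image emb)
      ∧ e₁ * e₂ = e₃ * (e₁ * e₂ / e₃) :=
  T3.FourthLine.fourth_line_admissible _ _ _ _
    (even_image_negative_lines emb hemb hc T hT h2 h4 h12 hs₁ hs₂ h34 hs₃ hs₄)
    h₁ h₁0 hΦ₁ h₂ h₂0 hΦ₂ h₃ h₃0 hΦ₃

/-! ### Existence of the four admissible lines on a face (v2 append)

For the Galois dictionary `emb g = φ₀ ∘ g` the map `emb` is a BIJECTION `G ≃ (E′ →+* ℂ)` with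
`conjugate (emb g) = emb (c * g)`; under these two properties the image of a CM type of the model is a CM type of
embeddings (one of each conjugate pair), so `T3AdmissibleSign.exists_conj_neg_im_neg` produces admissible lines
`e₁, e₂, e₃` for the three corner types and `fourth_line_admissible_of_face` the fourth — the four admissible lines
with `e₁ e₂ = e₃ e₄` EXIST on every face: (N1-disc) costs nothing. -/

omit [DecidableEq G] [NumberField L] [NumberField.IsCMField L] in
/-- Under a bijective, conjugation-compatible dictionary the image of a CM type of the model contains exactly one of
each pair of conjugate embeddings. -/
theorem mem_image_iff_conjugate_not_mem (emb : G → (L →+* ℂ)) (hemb : Function.Injective emb)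
    (hsurj : Function.Surjective emb) {c : G}
    (hconj : ∀ g : G, NumberField.ComplexEmbedding.conjugate (emb g) = emb (c * g)) {Φ : Finset G}
    (hΦ : IsCMType c Φ) (φ : L →+* ℂ) :
    φ ∈ Φ.image emb ↔ NumberField.ComplexEmbedding.conjugate φ ∉ Φ.image emb := by
  obtain ⟨g, rfl⟩ := hsurj φ
  rw [hconj g, hemb.mem_finset_image, hemb.mem_finset_image, (hΦ).conj_mem_iff g, not_not]

/-- **The four admissible lines of a face exist, with `e₁ e₂ = e₃ e₄`.**  For a bijective, conjugation-compatible
dictionary `emb : G → (L →+* ℂ)` and a face `T` with the component `s` and corners `i₁ ≠ i₂ ∋ s`, `i₃ ≠ i₄ ∋ c * s`,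
there are non-zero purely imaginary `e₁, e₂, e₃, e₄ ∈ L`, each admissible (two-sided) for its corner's CM type read on
the embeddings, with `e₁ e₂ = e₃ e₄` — the discriminant half of N1 is met by a choice on every face
(`proofs/t3-p2/R3R4-INSTANTIATION.md` §4.4 (N1-disc), now with the existence of the lines on the kernel too). -/
theorem exists_four_admissible_lines [Fintype G] (emb : G → (L →+* ℂ)) (hemb : Function.Injective emb)
    (hsurj : Function.Surjective emb) {c : G} (hc : IsComplexConj c)
    (hconj : ∀ g : G, NumberField.ComplexEmbedding.conjugate (emb g) = emb (c * g)) (T : ι → Finset G)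
    (hT : ∀ i, IsCMType c (T i)) (h2 : SumTwo T) (h4 : Fintype.card ι = 4) {s : G} {i₁ i₂ i₃ i₄ : ι}
    (h12 : i₁ ≠ i₂) (hs₁ : s ∈ T i₁) (hs₂ : s ∈ T i₂) (h34 : i₃ ≠ i₄) (hs₃ : c * s ∈ T i₃) (hs₄ : c * s ∈ T i₄) :
    ∃ e₁ e₂ e₃ e₄ : L,
      (IsCMField.complexConj L e₁ = -e₁ ∧ e₁ ≠ 0 ∧
        ∀ φ : L →+* ℂ, (φ e₁).im < 0 ↔ φ ∈ (s • liuType (T i₁)).image emb) ∧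
      (IsCMField.complexConj L e₂ = -e₂ ∧ e₂ ≠ 0 ∧
        ∀ φ : L →+* ℂ, (φ e₂).im < 0 ↔ φ ∈ (s • liuType (T i₂)).image emb) ∧
      (IsCMField.complexConj L e₃ = -e₃ ∧ e₃ ≠ 0 ∧
        ∀ φ : L →+* ℂ, (φ e₃).im < 0 ↔ φ ∈ ((c * s) • liuType (T i₃)).image emb) ∧
      (IsCMField.complexConj L e₄ = -e₄ ∧ e₄ ≠ 0 ∧
        ∀ φ : L →+* ℂ, (φ e₄).im < 0 ↔ φ ∈ ((c * s) • liuType (T i₄)).image emb) ∧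
      e₁ * e₂ = e₃ * e₄ := by
  -- the three chosen lines, from `T3AdmissibleSign.exists_conj_neg_im_neg`
  have hcm : ∀ (x : G) (i : ι), IsCMType c (x • liuType (T i)) := fun x i =>
    T3.CornerCharacter.isCMType_smul_liuType hc (hT i) x
  have key : ∀ (x : G) (i : ι), ∃ e : L, IsCMField.complexConj L e = -e ∧ e ≠ 0 ∧
      ∀ φ : L →+* ℂ, (φ e).im < 0 ↔ φ ∈ (x • liuType (T i)).image emb := by
    intro x i
    have hpair : ∀ φ ∈ (x • liuType (T i)).image emb,
        NumberField.ComplexEmbedding.conjugate φ ∉ (x • liuType (T i)).image emb := fun φ hφ =>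
      (mem_image_iff_conjugate_not_mem emb hemb hsurj hconj (hcm x i) φ).1 hφ
    obtain ⟨e, he, he0, hneg⟩ := T3.AdmissibleSign.exists_conj_neg_im_neg (L := L) _ hpair
    exact ⟨e, he, he0, T3.FourthLine.im_neg_iff_mem_of_cmType
      (mem_image_iff_conjugate_not_mem emb hemb hsurj hconj (hcm x i)) hneg⟩
  obtain ⟨e₁, h₁, h₁0, hΦ₁⟩ := key s i₁
  obtain ⟨e₂, h₂, h₂0, hΦ₂⟩ := key s i₂
  obtain ⟨e₃, h₃, h₃0, hΦ₃⟩ := key (c * s) i₃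
  obtain ⟨h₄, h₄0, hΦ₄, hprod⟩ := fourth_line_admissible_of_face emb hemb hc T hT h2 h4 h12 hs₁ hs₂ h34 hs₃ hs₄
    h₁ h₁0 hΦ₁ h₂ h₂0 hΦ₂ h₃ h₃0 hΦ₃
  exact ⟨e₁, e₂, e₃, e₁ * e₂ / e₃, ⟨h₁, h₁0, hΦ₁⟩, ⟨h₂, h₂0, hΦ₂⟩, ⟨h₃, h₃0, hΦ₃⟩, ⟨h₄, h₄0, hΦ₄⟩, hprod⟩

end T3.FaceFourthLine

end HodgeRepro
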